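import Summits.AtomisticToContinuum.BoseEinsteinCondensation.Theorems.BECInsertionCorrectorStaticResponseBoundTruncationMonotone
import HarnessLib

/-!
# Truncation of the pair potential at fixed volume, part 2/2: the compactness half and the reduction of
# `TruncationLimit` to the maximal-form bound

Helper file (part 2 of 2) for the stub `stub_truncationLimit` (`TruncationLimit`) of line
`uv-thomson-force-wave` of the crux `BECInsertionCorrector.StaticResponseBound`
(item stmt-AtomisticToContinuum-12057); sequel of `…TruncationMonotone.lean`. Classically
`E₀(min(v,n)) ↑ E₀(v)` at fixed `(N, L)` (hard cores allowed) is monotone convergence of non-densely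
defined closed forms [Simon 1978, Thms 3.1, 4.1] + compactness of the resolvent on the torus + the
statement that the Bose-symmetric periodic `C¹` functions realise the infimum of the MAXIMAL hard-core
form. Everything except the last statement is proved here (sorry-free, no new definitions):

* `exists_limitProfile` — **the compactness half** (Rellich + Fatou + Beppo Levi): if
  `supₙ E₀(vₙ) < ∞` there is a unit vector `η ∈ L²((ℝ/ℤ)^{3N})`, Bose-symmetric in momentum space,
  whose maximal-form energy `∑ₖ (2πk/L)² |⟪eₖ, η⟫|² + ∫ (W ∘ fromUnitTorusN)|η|²`
  (`W = periodicInteraction v L`, hard cores included, values in `[0, ∞]`) is `≤ supₙ E₀(vₙ)`.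
  Near-minimisers of the truncated problems are embedded in the FREE form domain of
  `PeriodicFormDomain.lean` (`v = 0`; `isCompactOperator_formEmbed` is Rellich's lemma), an
  `L²`-convergent subsequence is extracted, the spectral kinetic energy is lower semicontinuous
  (`tsum_mul_inner_sq_le_liminf`), the truncated potential energies pass to the limit by Fatou along an
  a.e.-convergent subsequence, and the truncation height is removed by monotone convergence.
  The dictionary `coeFn_formEmbed_trialState`, `inner_mFourierLp_formEmbed_trialState`,
  `tsum_kinetic_formEmbed_trialState` (`= ∫ |∇Ψ|²`, [LSSY2005, (A.10)]),
  `lintegral_pot_formEmbed_trialState` (`= ∫ W|Ψ|²`) identifies the embedded quantities.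
* `truncationLimit_of_maxFormBound` — **the reduction**: `TruncationLimit` (verbatim the registered
  stub statement) follows from the single fact `MaxFormBound` spelled out as its hypothesis `hcore`:
  for admissible `v`, `L > 0` and every unit `η ∈ L²((ℝ/ℤ)^{3N})` Bose-symmetric in momentum space,
  `periodicGroundStateEnergy v N L ≤ ∑ₖ (2πk/L)² |⟪eₖ, η⟫|² + ∫ (W ∘ fromUnitTorusN)|η|²` — the `C¹`
  Bose-symmetric periodic core realises the infimum of the maximal form `H¹ ∩ {∫ W|u|² < ∞}`. On
  paper: vanishing on a.e. ray at the non-`L¹_loc` radii of `v` (the hard set of `BoseGasHardSet.lean`),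
  a Hardy cut-off at the hard spheres, truncation and mollification [Simon, J. Operator Theory 1 (1979)
  37; Adams–Hedberg Thm 9.1.3]; this needs ACL representatives of Fourier-`H¹` classes, Hardy's
  inequality and form-norm mollification on the torus, none of which is in Mathlib or the tree — NOT
  proved here.

References: [ReedSimonIV1978] Thm XIII.64 (compact form embedding); [LSSY2005] App. A (A.10);
B. Simon, *J. Funct. Anal.* 28 (1978) 377–385 and *J. Operator Theory* 1 (1979) 37–47.
-/

noncomputable section

namespace Summit.AtomisticToContinuum.BoseEinsteinCondensation.Cruxes.StaticResponseBound.UvThomsonForceWave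

open MeasureTheory Filter UnitAddTorus
open scoped ENNReal NNReal BigOperators Topology InnerProductSpace
open Literature.MathematicalPhysics.QuantumManyBody.BoseGas

-- The measure on `ℝ/ℤ` is the Haar PROBABILITY measure, as in `PeriodicFormDomain.lean` (whose local
-- instances we re-activate, so that `Lp ℂ 2 volume` below is literally the target of `formEmbed`).
attribute [local instance] Literature.MathematicalPhysics.QuantumManyBody.BoseGas.formDomain_measureSpace
  Literature.MathematicalPhysics.QuantumManyBody.BoseGas.formDomain_isProbabilityMeasure
  Literature.MathematicalPhysics.QuantumManyBody.BoseGas.formDomain_isProbabilityMeasure_pi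

/-! ### The free form domain as a compactness device -/

section LimitProfile

variable {N : ℕ} {L : ℝ} {v : ℝ → ℝ≥0∞}

/-- The embedded `L²((ℝ/ℤ)^{3N})` class `ι(graphEmbed Ψ)` of a trial state in the FREE form domain
(`v = 0`), as a function on the torus: a.e. `L^{3N/2} Ψ ∘ fromUnitTorusN`. [folklore] -/
theorem coeFn_formEmbed_trialState (hL : 0 < L) (Ψ : PeriodicTrialState N L) :
    ∀ᵐ t ∂(volume : Measure (UnitAddTorus (Fin N × Fin 3))),
      (formEmbed hL measurable_zeroProfile (lintegral_periodicInteraction_zero_ne_top N L)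
          ⟨graphEmbed hL measurable_zeroProfile (lintegral_periodicInteraction_zero_ne_top N L)
            ⟨Ψ.ψ, Ψ.mem_periodicCore⟩, graphEmbed_mem_formDomain _ _ _ _⟩ :
        UnitAddTorus (Fin N × Fin 3) → ℂ) t = (cellScale N L : ℂ) * Ψ.ψ (fromUnitTorusN L t) := by
  have hΨ : ContDiff ℝ 1 Ψ.ψ := Ψ.contDiff
  have h := (Lp.coeFn_smul ((cellScale N L : ℝ) : ℂ)
    ((memLp_torusFunN_compFun hL measurable_zeroProfile (lintegral_periodicInteraction_zero_ne_top N L)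
      hΨ (Sum.inl ())).toLp _)).and
    (memLp_torusFunN_compFun hL measurable_zeroProfile (lintegral_periodicInteraction_zero_ne_top N L)
      hΨ (Sum.inl ())).coeFn_toLp
  filter_upwards [h] with t ht
  rw [formEmbed_apply]
  change (compLp hL measurable_zeroProfile (lintegral_periodicInteraction_zero_ne_top N L) hΨ (Sum.inl ()) :
    UnitAddTorus (Fin N × Fin 3) → ℂ) t = _
  unfold compLp
  rw [ht.1, Pi.smul_apply, ht.2]
  simp only [torusFunN, compFun_val, smul_eq_mul]

/-- The Fourier coefficients of the embedded class: `⟪eₙ, ι(graphEmbed Ψ)⟫ = L^{3N/2} ĉₙ(Ψ)`. [folklore] -/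
theorem inner_mFourierLp_formEmbed_trialState (hL : 0 < L) (Ψ : PeriodicTrialState N L)
    (n : Fin N × Fin 3 → ℤ) :
    ⟪(mFourierLp 2 n : Lp ℂ 2 (volume : Measure (UnitAddTorus (Fin N × Fin 3)))),
      formEmbed hL measurable_zeroProfile (lintegral_periodicInteraction_zero_ne_top N L)
        ⟨graphEmbed hL measurable_zeroProfile (lintegral_periodicInteraction_zero_ne_top N L)
          ⟨Ψ.ψ, Ψ.mem_periodicCore⟩, graphEmbed_mem_formDomain _ _ _ _⟩⟫_ℂ =
      (cellScale N L : ℂ) * configFourierCoeff L Ψ.ψ n := by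
  rw [formEmbed_apply]
  exact inner_mFourierLp_compLp_val hL measurable_zeroProfile
    (lintegral_periodicInteraction_zero_ne_top N L) Ψ.contDiff n

/-- **The spectral kinetic energy of the embedded class is the kinetic energy**:
`∑ₙ (2πn/L)² |⟪eₙ, ι(graphEmbed Ψ)⟫|² = ∫_{[0,L)^{3N}} |∇Ψ|²`. [cite: LSSY2005, App. A (A.10)] -/
theorem tsum_kinetic_formEmbed_trialState (hL : 0 < L) (Ψ : PeriodicTrialState N L) :
    ∑' n : Fin N × Fin 3 → ℤ, ENNReal.ofReal (∑ p, (2 * Real.pi * (n p : ℝ) / L) ^ 2) *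
        (‖⟪(mFourierLp 2 n : Lp ℂ 2 (volume : Measure (UnitAddTorus (Fin N × Fin 3)))),
          formEmbed hL measurable_zeroProfile (lintegral_periodicInteraction_zero_ne_top N L)
            ⟨graphEmbed hL measurable_zeroProfile (lintegral_periodicInteraction_zero_ne_top N L)
              ⟨Ψ.ψ, Ψ.mem_periodicCore⟩, graphEmbed_mem_formDomain _ _ _ _⟩⟫_ℂ‖₊ : ℝ≥0∞) ^ 2 =
      ∫⁻ X in cellN N L, kineticDensity Ψ.ψ X := by
  simp only [inner_mFourierLp_formEmbed_trialState hL Ψ, coe_nnnorm_real_mul_sq (cellScale_nonneg N L)]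
  simp only [mul_left_comm _ (ENNReal.ofReal (cellScale N L ^ 2))]
  rw [ENNReal.tsum_mul_left, tsum_sq_mul_sq_configFourierCoeff hL Ψ.contDiff Ψ.mem_periodicCore.2.1,
    ← mul_assoc, ofReal_cellScale_sq_mul_inv hL N, one_mul]

/-- **The potential energy of the embedded class** against any measurable weight transported to the
torus: `∫ (W ∘ fromUnitTorusN) |ι(graphEmbed Ψ)|² = ∫_{[0,L)^{3N}} W |Ψ|²`. [folklore] -/
theorem lintegral_pot_formEmbed_trialState (hL : 0 < L) (Ψ : PeriodicTrialState N L)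
    {W : Config N → ℝ≥0∞} (hW : Measurable W) :
    ∫⁻ t, W (fromUnitTorusN L t) *
        (‖(formEmbed hL measurable_zeroProfile (lintegral_periodicInteraction_zero_ne_top N L)
            ⟨graphEmbed hL measurable_zeroProfile (lintegral_periodicInteraction_zero_ne_top N L)
              ⟨Ψ.ψ, Ψ.mem_periodicCore⟩, graphEmbed_mem_formDomain _ _ _ _⟩ :
          UnitAddTorus (Fin N × Fin 3) → ℂ) t‖₊ : ℝ≥0∞) ^ 2 =
      ∫⁻ X in cellN N L, W X * (‖Ψ.ψ X‖₊ : ℝ≥0∞) ^ 2 := by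
  have hG : Measurable fun X : Config N => W X * (‖Ψ.ψ X‖₊ : ℝ≥0∞) ^ 2 :=
    hW.mul ((Ψ.contDiff.continuous.measurable.nnnorm.coe_nnreal_ennreal).pow_const 2)
  calc _ = ∫⁻ t, ENNReal.ofReal (cellScale N L ^ 2) *
        (W (fromUnitTorusN L t) * (‖Ψ.ψ (fromUnitTorusN L t)‖₊ : ℝ≥0∞) ^ 2) := by
        refine lintegral_congr_ae ((coeFn_formEmbed_trialState hL Ψ).mono fun t ht => ?_)
        dsimp only
        rw [ht, coe_nnnorm_real_mul_sq (cellScale_nonneg N L)]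
        ring
    _ = ENNReal.ofReal (cellScale N L ^ 2) * (((ENNReal.ofReal L ^ 3)⁻¹) ^ N *
          ∫⁻ X in cellN N L, W X * (‖Ψ.ψ X‖₊ : ℝ≥0∞) ^ 2) := by
        rw [lintegral_const_mul' _ _ ENNReal.ofReal_ne_top, lintegral_fromUnitTorusN hL hG]
    _ = _ := by rw [← mul_assoc, ofReal_cellScale_sq_mul_inv hL N, one_mul]


/-- **Compactness half of the truncation limit (Rellich + Fatou + Beppo Levi).** Fix `N`, `L > 0` and a
measurable profile `v` whose truncated periodic ground-state energies `E₀(min(v,n))` stay bounded. Then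
there is a unit vector `η ∈ L²((ℝ/ℤ)^{3N})` (an `L²`-limit of embedded near-minimisers of the truncated
problems, extracted by the compactness of the free form-domain embedding `isCompactOperator_formEmbed`)
whose MAXIMAL-form energy for the full potential `v` — spectral kinetic energy
`∑ₙ (2πn/L)² |⟪eₙ, η⟫|²` plus `∫ (W ∘ fromUnitTorusN) |η|²`, `W = ∑_{i<j} v^per(xᵢ - xⱼ)` (hard cores
allowed: `η` then vanishes a.e. on the core) — is at most `supₙ E₀(min(v,n))`. This is the
monotone-convergence-of-forms half of `TruncationLimit`; the remaining half is the density of the `C¹`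
core in the maximal form domain. [cite: ReedSimonIV1978, Thm. XIII.64] -/
theorem exists_limitProfile (hv : Measurable v) (hL : 0 < L)
    (hE : ⨆ n, periodicGroundStateEnergy (truncPotential v n) N L ≠ ⊤) :
    ∃ η : Lp ℂ 2 (volume : Measure (UnitAddTorus (Fin N × Fin 3))), ‖η‖ = 1 ∧
      (∀ (σ : Equiv.Perm (Fin N)) (n : Fin N × Fin 3 → ℤ),
        ⟪(mFourierLp 2 (fun p : Fin N × Fin 3 => n (σ p.1, p.2)) :
            Lp ℂ 2 (volume : Measure (UnitAddTorus (Fin N × Fin 3)))), η⟫_ℂ =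
          ⟪(mFourierLp 2 n : Lp ℂ 2 (volume : Measure (UnitAddTorus (Fin N × Fin 3)))), η⟫_ℂ) ∧
      ∑' n : Fin N × Fin 3 → ℤ, ENNReal.ofReal (∑ p, (2 * Real.pi * (n p : ℝ) / L) ^ 2) *
          (‖⟪(mFourierLp 2 n : Lp ℂ 2 (volume : Measure (UnitAddTorus (Fin N × Fin 3)))), η⟫_ℂ‖₊ :
            ℝ≥0∞) ^ 2 +
        ∫⁻ t, periodicInteraction v L (fromUnitTorusN L t) *
          (‖(η : UnitAddTorus (Fin N × Fin 3) → ℂ) t‖₊ : ℝ≥0∞) ^ 2 ≤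
      ⨆ n, periodicGroundStateEnergy (truncPotential v n) N L := by
  set Einf : ℝ≥0∞ := ⨆ n, periodicGroundStateEnergy (truncPotential v n) N L with hEinf
  have hEle : ∀ n, periodicGroundStateEnergy (truncPotential v n) N L ≤ Einf := fun n =>
    le_iSup (fun n => periodicGroundStateEnergy (truncPotential v n) N L) n
  -- near-minimisers `Ψ n` of the truncated problems
  set δ : ℕ → ℝ≥0∞ := fun n => ((n + 1 : ℕ) : ℝ≥0∞)⁻¹ with hδ
  have hδpos : ∀ n, 0 < δ n := fun n => ENNReal.inv_pos.2 (ENNReal.natCast_ne_top _)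
  have hδle : ∀ n, δ n ≤ 1 := fun n => ENNReal.inv_le_one.2 (by exact_mod_cast Nat.succ_pos n)
  have hδlim : Tendsto δ atTop (𝓝 0) :=
    ENNReal.tendsto_inv_nat_nhds_zero.comp (tendsto_add_atTop_nat 1)
  have hΨex : ∀ n, ∃ Ψ : PeriodicTrialState N L, periodicEnergy (truncPotential v n) Ψ < Einf + δ n :=
    fun n => iInf_lt_iff.1 ((hEle n).trans_lt (ENNReal.lt_add_right hE (hδpos n).ne'))
  choose Ψ hΨ using hΨex
  -- the FREE form domain as a compactness device
  set g : ℕ → formDomain hL measurable_zeroProfile (lintegral_periodicInteraction_zero_ne_top N L) :=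
    fun n => ⟨graphEmbed hL measurable_zeroProfile (lintegral_periodicInteraction_zero_ne_top N L)
      ⟨(Ψ n).ψ, (Ψ n).mem_periodicCore⟩, graphEmbed_mem_formDomain _ _ _ _⟩ with hg
  set f : ℕ → Lp ℂ 2 (volume : Measure (UnitAddTorus (Fin N × Fin 3))) := fun n =>
    formEmbed hL measurable_zeroProfile (lintegral_periodicInteraction_zero_ne_top N L) (g n) with hf
  have hf1 : ∀ n, ‖f n‖ = 1 := fun n =>
    norm_formEmbed_graphEmbed_trialState hL measurable_zeroProfile
      (lintegral_periodicInteraction_zero_ne_top N L) (Ψ n)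
  have hkin_le : ∀ n, ∫⁻ X in cellN N L, kineticDensity (Ψ n).ψ X ≤ Einf + 1 := fun n =>
    ((lintegral_kineticDensity_le_periodicEnergy _ (Ψ n)).trans (hΨ n).le).trans
      (add_le_add le_rfl (hδle n))
  have hgn : ∀ n, ‖g n‖ ^ 2 ≤ 2 + Einf.toReal := fun n => by
    have h1 : ‖g n‖ = ‖graphEmbed hL measurable_zeroProfile (lintegral_periodicInteraction_zero_ne_top N L)
        ⟨(Ψ n).ψ, (Ψ n).mem_periodicCore⟩‖ := rfl
    rw [h1, norm_graphEmbed_sq_trialState, periodicEnergy_zero_eq]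
    have h2 : (∫⁻ X in cellN N L, kineticDensity (Ψ n).ψ X).toReal ≤ (Einf + 1).toReal :=
      ENNReal.toReal_mono (ENNReal.add_ne_top.2 ⟨hE, ENNReal.one_ne_top⟩) (hkin_le n)
    rw [ENNReal.toReal_add hE ENNReal.one_ne_top, ENNReal.toReal_one] at h2
    linarith
  -- Rellich: an `L²`-convergent subsequence of the embedded near-minimisers
  set R : ℝ := Real.sqrt (2 + Einf.toReal) + 1 with hR
  have hball : ∀ n, g n ∈ Metric.ball (0 : formDomain hL measurable_zeroProfile
      (lintegral_periodicInteraction_zero_ne_top N L)) R := fun n => by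
    rw [Metric.mem_ball, dist_zero_right]
    have h := Real.abs_le_sqrt (hgn n)
    rw [abs_of_nonneg (norm_nonneg _)] at h
    linarith
  have hK : IsCompact (closure ((formEmbed hL measurable_zeroProfile
      (lintegral_periodicInteraction_zero_ne_top N L)) '' Metric.ball 0 R)) :=
    (isCompactOperator_formEmbed hL measurable_zeroProfile
      (lintegral_periodicInteraction_zero_ne_top N L)).isCompact_closure_image_ball
      (f := (formEmbed hL measurable_zeroProfile (lintegral_periodicInteraction_zero_ne_top N L) :
        formDomain hL measurable_zeroProfile (lintegral_periodicInteraction_zero_ne_top N L) →ₗ[ℂ]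
          Lp ℂ 2 (volume : Measure (UnitAddTorus (Fin N × Fin 3))))) R
  obtain ⟨η, -, φ, hφ, hconv⟩ := hK.tendsto_subseq (x := f) fun n => subset_closure ⟨g n, hball n, rfl⟩
  -- an a.e.-convergent further subsequence
  obtain ⟨ns, hns, hae⟩ := (tendstoInMeasure_of_tendsto_Lp hconv).exists_seq_tendsto_ae
  set ψ : ℕ → ℕ := φ ∘ ns with hψdef
  have hψ : StrictMono ψ := hφ.comp hns
  have hconvψ : Tendsto (fun i => f (ψ i)) atTop (𝓝 η) := hconv.comp hns.tendsto_atTop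
  have haeψ : ∀ᵐ t ∂(volume : Measure (UnitAddTorus (Fin N × Fin 3))),
      Tendsto (fun i => (f (ψ i) : UnitAddTorus (Fin N × Fin 3) → ℂ) t) atTop
        (𝓝 ((η : UnitAddTorus (Fin N × Fin 3) → ℂ) t)) := hae
  refine ⟨η, ?_, ?_, ?_⟩
  · -- `‖η‖ = 1`
    have h1 : Tendsto (fun i => ‖f (ψ i)‖) atTop (𝓝 ‖η‖) := (continuous_norm.tendsto η).comp hconvψ
    simp only [hf1] at h1
    exact tendsto_nhds_unique h1 tendsto_const_nhds
  · -- Bose symmetry in momentum space passes to the limit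
    intro σ n
    have hc : ∀ m : Fin N × Fin 3 → ℤ, Continuous fun x : Lp ℂ 2 (volume : Measure (UnitAddTorus (Fin N × Fin 3))) =>
        ⟪(mFourierLp 2 m : Lp ℂ 2 (volume : Measure (UnitAddTorus (Fin N × Fin 3)))), x⟫_ℂ :=
      fun m => continuous_const.inner continuous_id
    have h1 := ((hc (fun p : Fin N × Fin 3 => n (σ p.1, p.2))).tendsto η).comp hconvψ
    have h2 := ((hc n).tendsto η).comp hconvψ
    have h12 : (fun x : Lp ℂ 2 (volume : Measure (UnitAddTorus (Fin N × Fin 3))) =>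
        ⟪(mFourierLp 2 (fun p : Fin N × Fin 3 => n (σ p.1, p.2)) :
          Lp ℂ 2 (volume : Measure (UnitAddTorus (Fin N × Fin 3)))), x⟫_ℂ) ∘ (fun i => f (ψ i)) =
        (fun x : Lp ℂ 2 (volume : Measure (UnitAddTorus (Fin N × Fin 3))) =>
          ⟪(mFourierLp 2 n : Lp ℂ 2 (volume : Measure (UnitAddTorus (Fin N × Fin 3)))), x⟫_ℂ) ∘
            (fun i => f (ψ i)) := by
      funext i
      simp only [Function.comp_apply, hf]
      rw [inner_mFourierLp_formEmbed_trialState, inner_mFourierLp_formEmbed_trialState,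
        configFourierCoeff_perm (Ψ (ψ i)).symm]
    rw [h12] at h1
    exact tendsto_nhds_unique h1 h2
  · -- the energy bound, first at each truncation height `m`
    have hm : ∀ m : ℕ,
        ∑' n : Fin N × Fin 3 → ℤ, ENNReal.ofReal (∑ p, (2 * Real.pi * (n p : ℝ) / L) ^ 2) *
            (‖⟪(mFourierLp 2 n : Lp ℂ 2 (volume : Measure (UnitAddTorus (Fin N × Fin 3)))), η⟫_ℂ‖₊ :
              ℝ≥0∞) ^ 2 +
          ∫⁻ t, periodicInteraction (truncPotential v m) L (fromUnitTorusN L t) *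
            (‖(η : UnitAddTorus (Fin N × Fin 3) → ℂ) t‖₊ : ℝ≥0∞) ^ 2 ≤ Einf := by
      intro m
      have hWm : Measurable (periodicInteraction (N := N) (truncPotential v m) L) :=
        measurable_periodicInteraction_trunc (measurable_truncPotential hv m) L
      -- lower semicontinuity of the kinetic energy
      have hkin : ∑' n : Fin N × Fin 3 → ℤ, ENNReal.ofReal (∑ p, (2 * Real.pi * (n p : ℝ) / L) ^ 2) *
            (‖⟪(mFourierLp 2 n : Lp ℂ 2 (volume : Measure (UnitAddTorus (Fin N × Fin 3)))), η⟫_ℂ‖₊ :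
              ℝ≥0∞) ^ 2 ≤
          liminf (fun i => ∫⁻ X in cellN N L, kineticDensity (Ψ (ψ i)).ψ X) atTop := by
        have h := tsum_mul_inner_sq_le_liminf
          (fun n : Fin N × Fin 3 → ℤ => (mFourierLp 2 n : Lp ℂ 2 (volume : Measure (UnitAddTorus (Fin N × Fin 3)))))
          (w := fun n : Fin N × Fin 3 → ℤ => ENNReal.ofReal (∑ p, (2 * Real.pi * (n p : ℝ) / L) ^ 2))
          (fun _ => ENNReal.ofReal_ne_top) hconvψ
        refine h.trans_eq ?_
        congr 1
        funext i
        exact tsum_kinetic_formEmbed_trialState hL (Ψ (ψ i))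
      -- Fatou for the (bounded-height) potential energy
      have hpot : ∫⁻ t, periodicInteraction (truncPotential v m) L (fromUnitTorusN L t) *
            (‖(η : UnitAddTorus (Fin N × Fin 3) → ℂ) t‖₊ : ℝ≥0∞) ^ 2 ≤
          liminf (fun i => ∫⁻ X in cellN N L, periodicInteraction (truncPotential v m) L X *
            (‖(Ψ (ψ i)).ψ X‖₊ : ℝ≥0∞) ^ 2) atTop := by
        calc ∫⁻ t, periodicInteraction (truncPotential v m) L (fromUnitTorusN L t) *
              (‖(η : UnitAddTorus (Fin N × Fin 3) → ℂ) t‖₊ : ℝ≥0∞) ^ 2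
            ≤ ∫⁻ t, liminf (fun i => periodicInteraction (truncPotential v m) L (fromUnitTorusN L t) *
                (‖(f (ψ i) : UnitAddTorus (Fin N × Fin 3) → ℂ) t‖₊ : ℝ≥0∞) ^ 2) atTop := by
              refine lintegral_mono_ae (haeψ.mono fun t ht => ?_)
              have hsq : Tendsto (fun i => (‖(f (ψ i) : UnitAddTorus (Fin N × Fin 3) → ℂ) t‖₊ : ℝ≥0∞) ^ 2)
                  atTop (𝓝 ((‖(η : UnitAddTorus (Fin N × Fin 3) → ℂ) t‖₊ : ℝ≥0∞) ^ 2)) :=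
                ((ENNReal.continuous_pow 2).tendsto _).comp
                  ((ENNReal.continuous_coe.tendsto _).comp ht.nnnorm)
              rw [← hsq.liminf_eq]
              exact mul_liminf_le _ _
          _ ≤ liminf (fun i => ∫⁻ t, periodicInteraction (truncPotential v m) L (fromUnitTorusN L t) *
                (‖(f (ψ i) : UnitAddTorus (Fin N × Fin 3) → ℂ) t‖₊ : ℝ≥0∞) ^ 2) atTop :=
              lintegral_liminf_le' fun i => ((hWm.comp (measurable_fromUnitTorusN L)).aemeasurable.mul
                ((Lp.aestronglyMeasurable (f (ψ i))).aemeasurable.nnnorm.coe_nnreal_ennreal.pow_const 2))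
          _ = liminf (fun i => ∫⁻ X in cellN N L, periodicInteraction (truncPotential v m) L X *
                (‖(Ψ (ψ i)).ψ X‖₊ : ℝ≥0∞) ^ 2) atTop := by
              congr 1
              funext i
              exact lintegral_pot_formEmbed_trialState hL (Ψ (ψ i)) hWm
      -- combine and use the near-minimising property along `ψ i ≥ m`
      set KINi : ℕ → ℝ≥0∞ := fun i => ∫⁻ X in cellN N L, kineticDensity (Ψ (ψ i)).ψ X with hKINi
      set POTi : ℕ → ℝ≥0∞ := fun i => ∫⁻ X in cellN N L, periodicInteraction (truncPotential v m) L X *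
          (‖(Ψ (ψ i)).ψ X‖₊ : ℝ≥0∞) ^ 2 with hPOTi
      have hsum : ∀ i, KINi i + POTi i = periodicEnergy (truncPotential v m) (Ψ (ψ i)) := fun i => by
        simp only [hKINi, hPOTi, periodicEnergy]
        rw [← lintegral_add_left (measurable_kineticDensity_any (Ψ (ψ i)).ψ)]
      have hev : ∀ᶠ i in atTop, KINi i + POTi i ≤ Einf + δ (ψ i) := by
        filter_upwards [hψ.tendsto_atTop.eventually (eventually_ge_atTop m)] with i hi
        rw [hsum i]
        exact (monotone_periodicEnergy_truncPotential v (Ψ (ψ i)) hi).trans (hΨ (ψ i)).le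
      have hlim : Tendsto (fun i => Einf + δ (ψ i)) atTop (𝓝 Einf) := by
        have := (tendsto_const_nhds (x := Einf)).add (hδlim.comp hψ.tendsto_atTop)
        rwa [add_zero] at this
      calc _ ≤ liminf KINi atTop + liminf POTi atTop := add_le_add hkin hpot
        _ ≤ liminf (fun i => KINi i + POTi i) atTop := liminf_add_liminf_le KINi POTi
        _ ≤ liminf (fun i => Einf + δ (ψ i)) atTop := liminf_le_liminf hev
        _ = Einf := hlim.liminf_eq
    -- Beppo Levi in the truncation height
    have hmeas_m : ∀ m, AEMeasurable (fun t => periodicInteraction (truncPotential v m) L (fromUnitTorusN L t) *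
        (‖(η : UnitAddTorus (Fin N × Fin 3) → ℂ) t‖₊ : ℝ≥0∞) ^ 2) volume := fun m =>
      ((measurable_periodicInteraction_trunc (measurable_truncPotential hv m) L).comp
        (measurable_fromUnitTorusN L)).aemeasurable.mul
        ((Lp.aestronglyMeasurable η).aemeasurable.nnnorm.coe_nnreal_ennreal.pow_const 2)
    have hsup : ∫⁻ t, periodicInteraction v L (fromUnitTorusN L t) *
          (‖(η : UnitAddTorus (Fin N × Fin 3) → ℂ) t‖₊ : ℝ≥0∞) ^ 2 =
        ⨆ m, ∫⁻ t, periodicInteraction (truncPotential v m) L (fromUnitTorusN L t) *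
          (‖(η : UnitAddTorus (Fin N × Fin 3) → ℂ) t‖₊ : ℝ≥0∞) ^ 2 := by
      rw [← lintegral_iSup' hmeas_m (Eventually.of_forall fun t => fun m m' h => by
        dsimp only
        gcongr
        exact monotone_periodicInteraction_truncPotential v L _ h)]
      refine lintegral_congr fun t => ?_
      rw [← ENNReal.iSup_mul, iSup_periodicInteraction_truncPotential]
    rw [hsup, ENNReal.add_iSup]
    exact iSup_le hm

end LimitProfile

/-! ### The reduction of the stub to the maximal-form bound -/

section Reduction

/-- **Reduction of `TruncationLimit` to ONE missing fact (`MaxFormBound`, the hypothesis `hcore`).**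
If for every admissible `v`, every `N`, `L > 0` and every unit vector `η ∈ L²((ℝ/ℤ)^{3N})` that is
Bose-symmetric in momentum space the `C¹`-core ground-state energy is bounded by the maximal-form energy
of `η` (spectral kinetic energy plus `∫ (W ∘ fromUnitTorusN)|η|²`, in `[0, ∞]`), then the registered stub
holds: `E₀(v) ≤ (maximal form)(η) ≤ supₙ E₀(vₙ)` for the limit profile `η` of `exists_limitProfile`, and
`E₀(vₙ) ↑ supₙ E₀(vₙ)` in `ℝ`. [folklore] -/
theorem truncationLimit_of_maxFormBound
    (hcore : ∀ v : ℝ → ℝ≥0∞, IsRepulsiveFiniteRange v → ∀ (N : ℕ) (L : ℝ), 0 < L →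
      ∀ η : Lp ℂ 2 (volume : Measure (UnitAddTorus (Fin N × Fin 3))), ‖η‖ = 1 →
        (∀ (σ : Equiv.Perm (Fin N)) (n : Fin N × Fin 3 → ℤ),
          ⟪(mFourierLp 2 (fun p : Fin N × Fin 3 => n (σ p.1, p.2)) :
              Lp ℂ 2 (volume : Measure (UnitAddTorus (Fin N × Fin 3)))), η⟫_ℂ =
            ⟪(mFourierLp 2 n : Lp ℂ 2 (volume : Measure (UnitAddTorus (Fin N × Fin 3)))), η⟫_ℂ) →
        periodicGroundStateEnergy v N L ≤
          ∑' n : Fin N × Fin 3 → ℤ, ENNReal.ofReal (∑ p, (2 * Real.pi * (n p : ℝ) / L) ^ 2) *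
              (‖⟪(mFourierLp 2 n : Lp ℂ 2 (volume : Measure (UnitAddTorus (Fin N × Fin 3)))), η⟫_ℂ‖₊ :
                ℝ≥0∞) ^ 2 +
            ∫⁻ t, periodicInteraction v L (fromUnitTorusN L t) *
              (‖(η : UnitAddTorus (Fin N × Fin 3) → ℂ) t‖₊ : ℝ≥0∞) ^ 2) :
    ∀ v : ℝ → ℝ≥0∞, IsRepulsiveFiniteRange v → ∀ (N : ℕ) (L : ℝ), 0 < L →
      periodicGroundStateEnergy v N L ≠ ⊤ →
      ∀ ε : ℝ, 0 < ε → ∃ n₁ : ℕ, ∀ n : ℕ, n₁ ≤ n →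
        (periodicGroundStateEnergy v N L).toReal ≤
          (periodicGroundStateEnergy (truncPotential v n) N L).toReal + ε := by
  intro v hv N L hL hfin ε hε
  set E : ℕ → ℝ≥0∞ := fun n => periodicGroundStateEnergy (truncPotential v n) N L with hE
  have hsup_le : (⨆ n, E n) ≤ periodicGroundStateEnergy v N L :=
    iSup_le fun n => periodicGroundStateEnergy_truncPotential_le' v n N L
  have hsup_ne : (⨆ n, E n) ≠ ⊤ := ne_top_of_le_ne_top hfin hsup_le
  obtain ⟨η, hη1, hηsymm, hηE⟩ := exists_limitProfile hv.1 hL hsup_ne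
  have hge : periodicGroundStateEnergy v N L ≤ ⨆ n, E n := (hcore v hv N L hL η hη1 hηsymm).trans hηE
  have htend : Tendsto (fun n => (E n).toReal) atTop (𝓝 (⨆ n, E n).toReal) :=
    (ENNReal.tendsto_toReal hsup_ne).comp
      (tendsto_atTop_iSup (monotone_periodicGroundStateEnergy_truncPotential v N L))
  obtain ⟨n₁, hn₁⟩ := eventually_atTop.1 (htend.eventually (Ioi_mem_nhds (sub_lt_self _ hε)))
  refine ⟨n₁, fun n hn => ?_⟩
  have h1 : (periodicGroundStateEnergy v N L).toReal ≤ (⨆ n, E n).toReal := ENNReal.toReal_mono hsup_ne hge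
  have h2 : (⨆ n, E n).toReal - ε < (E n).toReal := hn₁ n hn
  change (periodicGroundStateEnergy v N L).toReal ≤ (E n).toReal + ε
  linarith

end Reduction

/-! ### Registered sub-goal of the crux item (part 2/2) -/

/-- **Registered sub-goal `stub_truncationLimit_of_maxFormBound`** (item stmt-AtomisticToContinuum-12057,
line `uv-thomson-force-wave`): `MaxFormBound → TruncationLimit`, i.e. the registered stub S2 follows from
the density of the Bose-symmetric periodic `C¹` core in the maximal hard-core form
(`truncationLimit_of_maxFormBound`). [folklore] -/
theorem stub_truncationLimit_of_maxFormBound :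
    (∀ v : ℝ → ℝ≥0∞, IsRepulsiveFiniteRange v → ∀ (N : ℕ) (L : ℝ), 0 < L →
      ∀ η : Lp ℂ 2 (volume : Measure (UnitAddTorus (Fin N × Fin 3))), ‖η‖ = 1 →
        (∀ (σ : Equiv.Perm (Fin N)) (n : Fin N × Fin 3 → ℤ),
          ⟪(mFourierLp 2 (fun p : Fin N × Fin 3 => n (σ p.1, p.2)) :
              Lp ℂ 2 (volume : Measure (UnitAddTorus (Fin N × Fin 3)))), η⟫_ℂ =
            ⟪(mFourierLp 2 n : Lp ℂ 2 (volume : Measure (UnitAddTorus (Fin N × Fin 3)))), η⟫_ℂ) →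
        periodicGroundStateEnergy v N L ≤
          ∑' n : Fin N × Fin 3 → ℤ, ENNReal.ofReal (∑ p, (2 * Real.pi * (n p : ℝ) / L) ^ 2) *
              (‖⟪(mFourierLp 2 n : Lp ℂ 2 (volume : Measure (UnitAddTorus (Fin N × Fin 3)))), η⟫_ℂ‖₊ :
                ℝ≥0∞) ^ 2 +
            ∫⁻ t, periodicInteraction v L (fromUnitTorusN L t) *
              (‖(η : UnitAddTorus (Fin N × Fin 3) → ℂ) t‖₊ : ℝ≥0∞) ^ 2) →
    ∀ v : ℝ → ℝ≥0∞, IsRepulsiveFiniteRange v → ∀ (N : ℕ) (L : ℝ), 0 < L →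
      periodicGroundStateEnergy v N L ≠ ⊤ →
      ∀ ε : ℝ, 0 < ε → ∃ n₁ : ℕ, ∀ n : ℕ, n₁ ≤ n →
        (periodicGroundStateEnergy v N L).toReal ≤
          (periodicGroundStateEnergy (truncPotential v n) N L).toReal + ε :=
  fun hcore => truncationLimit_of_maxFormBound hcore

end Summit.AtomisticToContinuum.BoseEinsteinCondensation.Cruxes.StaticResponseBound.UvThomsonForceWave

end
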